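import Literature.MathematicalPhysics.QuantumLattice.ApproximateEigenvectorLemmas
import Literature.MathematicalPhysics.QuantumLattice.HubbardLSMFillingProofs
import Literature.MathematicalPhysics.QuantumLattice.SectorSpectrum
import Literature.MathematicalPhysics.QuantumLattice.HubbardModelParticleHoleProofs
import Literature.MathematicalPhysics.QuantumLattice.HubbardOneParticleCost

/-!
# Route `JosephsonMirror` — zero-excess pair order ⇒ Josephson gain: abstract tools

Helper file (1 of 2) for the crux stmt-HubbardSuperconductivity-2227 (`JmInterchange`) of route
`JosephsonMirror` (sub-problem `HubbardSuperconductivity`), line `Sketch`, stub `stub_zepoGivesHyp`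
(the converse half `ZEPOGivesHyp` of the normal form, proved in
`Theorems/JosephsonMirrorJmInterchangeZepoGivesHyp`). Finite-dimensional tools of the Koma–Tasaki
trial-pair argument:

* `re_cross_le_of_form_nonneg` — weighted Cauchy–Schwarz (AM–GM) for the nonnegative Hermitian form
  `Re⟨·, (H - e)·⟩` on a subspace where `H ≥ e`;
* `partner_excess_le` — the excess of the pair partner `Qv` of a low-excess vector `v`:
  `Re⟨Qv, HQv⟩ - e₂‖Qv‖² ≤ (2‖H‖ + η)‖Q‖⁴/(2s) + (s/2)η + ‖Q‖‖[H, Q]‖ + (e₁ - e₂)‖Qv‖²`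
  (`HQv = QHv + [H, Q]v` and the weighted Cauchy–Schwarz for the cross term);
* `gain_endgame` — the real bookkeeping turning the trial-pair bound into `(c'/2) J L² ≤ E(0) - E(J)`;
* `re_rayleigh_hubbardTorusWith` — `Re⟨z, (H - μN̂)z⟩ = Re⟨z, Hz⟩ - μN‖z‖²` on `N`-particle vectors.

Sources: T. Koma, H. Tasaki, J. Stat. Phys. 76 (1994) 745, proof of Theorem 2.2; H. Tasaki,
*Physics and Mathematics of Quantum Many-Body Systems* (2020) §2.2. All statements are folklore
finite-dimensional linear algebra. No new definitions.
-/

-- the mandated namespace `Summit.<Summit>.<Problem>.Theorems` repeats `HubbardSuperconductivity`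
-- (single-problem summit, D-0017), which the `dupNamespace` linter flags on every declaration
set_option linter.dupNamespace false

namespace Summit.HubbardSuperconductivity.HubbardSuperconductivity.Theorems.JosephsonMirror

open Matrix Literature.MathematicalPhysics.QuantumLattice
open Literature.MathematicalPhysics.QuantumLattice.ThermodynamicLimit (star_mulVec_dotProduct)
open scoped ComplexOrder Matrix.Norms.L2Operator

section Abstract

variable {ι : Type*} [Fintype ι] [DecidableEq ι]

omit [DecidableEq ι] in
/-- Scaling: `Re⟨r z, r w⟩ = |r|² Re⟨z, w⟩`. [folklore] -/
theorem re_star_smul_dotProduct_smul (r : ℂ) (z w : ι → ℂ) :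
    (star (r • z) ⬝ᵥ (r • w)).re = ‖r‖ ^ 2 * (star z ⬝ᵥ w).re := by
  rw [star_smul, smul_dotProduct, dotProduct_smul, smul_smul, smul_eq_mul, Complex.star_def,
    ← Complex.normSq_eq_conj_mul_self, Complex.re_ofReal_mul, Complex.normSq_eq_norm_sq]

omit [DecidableEq ι] in
/-- Normalisation with the scaling factor recorded: a vector of positive norm has a unit multiple
`r • v` with `|r|² ‖v‖² = 1`. [folklore] -/
theorem exists_smul_unit_of_pos {v : ι → ℂ} (hv : 0 < (star v ⬝ᵥ v).re) :
    ∃ r : ℂ, star (r • v) ⬝ᵥ (r • v) = 1 ∧ ‖r‖ ^ 2 * (star v ⬝ᵥ v).re = 1 := by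
  classical
  have hv0 : v ≠ 0 := by
    rintro rfl
    simp at hv
  obtain ⟨r, -, hr⟩ := exists_smul_unit hv0
  refine ⟨r, hr, ?_⟩
  have h := congrArg Complex.re hr
  rwa [re_star_smul_dotProduct_smul, Complex.one_re] at h

omit [DecidableEq ι] in
/-- **Weighted Cauchy–Schwarz (AM–GM) for a nonnegative Hermitian form on a subspace.** If `H` is
Hermitian and `Re⟨z, Hz⟩ ≥ e ‖z‖²` on the subspace `K`, then for `x, y ∈ K` and `s > 0` the cross
term of the form `q(z) = Re⟨z, (H - e) z⟩` obeys `q(x, y) ≤ q(x)/(2s) + (s/2) q(y)`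
(expand `0 ≤ q(x - s y)`). [folklore] -/
theorem re_cross_le_of_form_nonneg {H : Matrix ι ι ℂ} (hH : H.IsHermitian)
    (K : Submodule ℂ (ι → ℂ)) (e : ℝ)
    (hK : ∀ z ∈ K, e * (star z ⬝ᵥ z).re ≤ (star z ⬝ᵥ H *ᵥ z).re)
    {x y : ι → ℂ} (hx : x ∈ K) (hy : y ∈ K) {s : ℝ} (hs : 0 < s) :
    (star x ⬝ᵥ H *ᵥ y).re - e * (star x ⬝ᵥ y).re ≤
      ((star x ⬝ᵥ H *ᵥ x).re - e * (star x ⬝ᵥ x).re) / (2 * s) +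
        s / 2 * ((star y ⬝ᵥ H *ᵥ y).re - e * (star y ⬝ᵥ y).re) := by
  have h := hK _ (K.sub_mem hx (K.smul_mem ((s : ℝ) : ℂ) hy))
  -- Hermitian symmetry of the two cross terms
  have hsym : (star y ⬝ᵥ H *ᵥ x).re = (star x ⬝ᵥ H *ᵥ y).re := by
    rw [star_dotProduct y (H *ᵥ x), star_mulVec, ← dotProduct_mulVec, hH.eq, Complex.star_def,
      Complex.conj_re]
  have hsym' : (star y ⬝ᵥ x).re = (star x ⬝ᵥ y).re := by
    rw [star_dotProduct y x, Complex.star_def, Complex.conj_re]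
  -- expansions of `Re⟨x - s y, H (x - s y)⟩` and `‖x - s y‖²`
  have hH' : (star (x - (s : ℂ) • y) ⬝ᵥ H *ᵥ (x - (s : ℂ) • y)).re =
      (star x ⬝ᵥ H *ᵥ x).re - 2 * s * (star x ⬝ᵥ H *ᵥ y).re +
        s ^ 2 * (star y ⬝ᵥ H *ᵥ y).re := by
    rw [mulVec_sub, mulVec_smul, star_sub, star_smul, sub_dotProduct, dotProduct_sub,
      dotProduct_sub, smul_dotProduct, smul_dotProduct, dotProduct_smul, dotProduct_smul, smul_smul]
    simp only [smul_eq_mul, Complex.sub_re, Complex.star_def, Complex.conj_ofReal,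
      ← Complex.ofReal_mul, Complex.re_ofReal_mul, hsym]
    ring
  have hn' : (star (x - (s : ℂ) • y) ⬝ᵥ (x - (s : ℂ) • y)).re =
      (star x ⬝ᵥ x).re - 2 * s * (star x ⬝ᵥ y).re + s ^ 2 * (star y ⬝ᵥ y).re := by
    rw [star_sub, star_smul, sub_dotProduct, dotProduct_sub, dotProduct_sub, smul_dotProduct,
      smul_dotProduct, dotProduct_smul, dotProduct_smul, smul_smul]
    simp only [smul_eq_mul, Complex.sub_re, Complex.star_def, Complex.conj_ofReal,
      ← Complex.ofReal_mul, Complex.re_ofReal_mul, hsym']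
    ring
  rw [hH', hn'] at h
  rw [div_add' _ _ _ (by positivity : (2 * s) ≠ 0), le_div_iff₀ (by positivity)]
  nlinarith [h]

/-- **The excess of the pair partner (Koma–Tasaki bookkeeping).** Let `H` be Hermitian with
`Re⟨z, Hz⟩ ≥ e₁‖z‖²` on the subspace `K`, `v ∈ K` a unit vector with `Re⟨v, Hv⟩ ≤ e₁ + η`, and
`Q` a matrix with `QᴴQ v ∈ K`. Then for every `s > 0` and real `e₂`,
`Re⟨Qv, HQv⟩ - e₂‖Qv‖² ≤ (2‖H‖ + η)‖Q‖⁴/(2s) + (s/2)η + ‖Q‖ ‖[H, Q]‖ + (e₁ - e₂)‖Qv‖²`: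
write `HQv = QHv + [H, Q]v`, `⟨Qv, QHv⟩ = ⟨QᴴQv, (H - e₁)v⟩ + e₁‖Qv‖²`, and bound the cross term
of the nonnegative form `Re⟨·, (H - e₁)·⟩` on `K` by `re_cross_le_of_form_nonneg`.
Koma–Tasaki, J. Stat. Phys. 76 (1994) 745, proof of Theorem 2.2. [folklore] -/
theorem partner_excess_le {H Q : Matrix ι ι ℂ} (hH : H.IsHermitian) (K : Submodule ℂ (ι → ℂ))
    {e₁ e₂ η s : ℝ} (hK : ∀ z ∈ K, e₁ * (star z ⬝ᵥ z).re ≤ (star z ⬝ᵥ H *ᵥ z).re)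
    {v : ι → ℂ} (hv : v ∈ K) (hx : Qᴴ *ᵥ (Q *ᵥ v) ∈ K) (hv1 : star v ⬝ᵥ v = 1)
    (hexc : (star v ⬝ᵥ H *ᵥ v).re ≤ e₁ + η) (hs : 0 < s) :
    (star (Q *ᵥ v) ⬝ᵥ H *ᵥ (Q *ᵥ v)).re - e₂ * (star (Q *ᵥ v) ⬝ᵥ (Q *ᵥ v)).re ≤
      (2 * ‖H‖ + η) * ‖Q‖ ^ 4 / (2 * s) + s / 2 * η + ‖Q‖ * ‖H * Q - Q * H‖ +
        (e₁ - e₂) * (star (Q *ᵥ v) ⬝ᵥ (Q *ᵥ v)).re := by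
  set x : ι → ℂ := Qᴴ *ᵥ (Q *ᵥ v) with hxdef
  have hv1' : eucNorm v = 1 := eucNorm_eq_one hv1
  have hQv : eucNorm (Q *ᵥ v) ≤ ‖Q‖ := by simpa [hv1'] using eucNorm_mulVec_le Q v
  have hxn : eucNorm x ≤ ‖Q‖ * ‖Q‖ :=
    (eucNorm_mulVec_le _ _).trans (by
      rw [Matrix.l2_opNorm_conjTranspose]
      exact mul_le_mul_of_nonneg_left hQv (norm_nonneg _))
  have hxx0 : 0 ≤ (star x ⬝ᵥ x).re := by rw [← eucNorm_sq]; positivity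
  have hxx : (star x ⬝ᵥ x).re ≤ ‖Q‖ ^ 4 := by
    rw [← eucNorm_sq]
    calc eucNorm x ^ 2 ≤ (‖Q‖ * ‖Q‖) ^ 2 := pow_le_pow_left₀ (eucNorm_nonneg _) hxn 2
      _ = ‖Q‖ ^ 4 := by ring
  -- `η ≥ 0` and `-e₁ ≤ ‖H‖ + η`
  have hη : 0 ≤ η := by
    have h := hK v hv
    rw [hv1, Complex.one_re, mul_one] at h
    linarith
  have he₁ : -e₁ ≤ ‖H‖ + η := by
    have h := (neg_le_abs _).trans (Matrix.abs_re_star_dotProduct_mulVec_le H v)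
    rw [hv1, Complex.one_re, mul_one] at h
    linarith
  -- the commutator term
  have hcomm : (star (Q *ᵥ v) ⬝ᵥ (H * Q - Q * H) *ᵥ v).re ≤ ‖Q‖ * ‖H * Q - Q * H‖ := by
    refine (Complex.re_le_norm _).trans ((norm_star_dotProduct_le _ _).trans ?_)
    have h2 : eucNorm ((H * Q - Q * H) *ᵥ v) ≤ ‖H * Q - Q * H‖ := by
      simpa [hv1'] using eucNorm_mulVec_le (H * Q - Q * H) v
    exact mul_le_mul hQv h2 (eucNorm_nonneg _) (norm_nonneg _)
  -- the cross term
  have hcross := re_cross_le_of_form_nonneg hH K e₁ hK hx hv hs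
  have hqv : s / 2 * ((star v ⬝ᵥ H *ᵥ v).re - e₁ * (star v ⬝ᵥ v).re) ≤ s / 2 * η := by
    refine mul_le_mul_of_nonneg_left ?_ (by positivity)
    rw [hv1, Complex.one_re, mul_one]
    linarith
  have hqx : ((star x ⬝ᵥ H *ᵥ x).re - e₁ * (star x ⬝ᵥ x).re) / (2 * s) ≤
      (2 * ‖H‖ + η) * ‖Q‖ ^ 4 / (2 * s) := by
    refine div_le_div_of_nonneg_right ?_ (by positivity)
    have h1 := (le_abs_self _).trans (Matrix.abs_re_star_dotProduct_mulVec_le H x)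
    calc (star x ⬝ᵥ H *ᵥ x).re - e₁ * (star x ⬝ᵥ x).re
        ≤ ‖H‖ * (star x ⬝ᵥ x).re + (‖H‖ + η) * (star x ⬝ᵥ x).re := by nlinarith
      _ = (2 * ‖H‖ + η) * (star x ⬝ᵥ x).re := by ring
      _ ≤ (2 * ‖H‖ + η) * ‖Q‖ ^ 4 := mul_le_mul_of_nonneg_left hxx (by positivity)
  -- the identities `⟨Qv, Q(Hv)⟩ = ⟨x, Hv⟩`, `⟨x, v⟩ = ‖Qv‖²`, `HQv = QHv + [H,Q]v`
  have hid1 : star x ⬝ᵥ H *ᵥ v = star (Q *ᵥ v) ⬝ᵥ Q *ᵥ (H *ᵥ v) := by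
    rw [hxdef, star_mulVec_dotProduct, conjTranspose_conjTranspose]
  have hid2 : star x ⬝ᵥ v = star (Q *ᵥ v) ⬝ᵥ (Q *ᵥ v) := by
    rw [hxdef, star_mulVec_dotProduct, conjTranspose_conjTranspose]
  have hsplit : H *ᵥ (Q *ᵥ v) = Q *ᵥ (H *ᵥ v) + (H * Q - Q * H) *ᵥ v := by
    rw [sub_mulVec, ← mulVec_mulVec, ← mulVec_mulVec]
    abel
  have hmain : (star (Q *ᵥ v) ⬝ᵥ H *ᵥ (Q *ᵥ v)).re =
      (star x ⬝ᵥ H *ᵥ v).re + (star (Q *ᵥ v) ⬝ᵥ (H * Q - Q * H) *ᵥ v).re := by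
    rw [hsplit, dotProduct_add, Complex.add_re, hid1]
  rw [hid2] at hcross
  rw [hmain]
  linarith

/-- **Real bookkeeping of the gain.** From the trial-pair bound `J S/X - e_v - e_w ≤ G`
(`X = L²`, `S = ‖Δv‖² ≥ c'X²`), the excesses `e_v ≤ εX` and
`e_w S ≤ ΦX⁵/(2s) + (s/2)εX + ΓX² + C₃S` at `s = σX²`, and the choices `ε ≤ c'J/8`,
`Φ/(2σc') ≤ c'J/8`, `σε/(2c') ≤ c'J/8`, `X ≥ 8(Γ/c' + C₃)/(c'J)`: `(c'/2) J X ≤ G`. [folklore] -/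
theorem gain_endgame {J X Sx c' ε σ Φ Γ C₃ ev ew G : ℝ} (hJ : 0 < J) (hX : 0 < X)
    (hc' : 0 < c') (hΓ : 0 ≤ Γ) (hσ : 0 < σ)
    (hkey : J * (Sx / X) - ev - ew ≤ G) (hS : c' * X ^ 2 ≤ Sx) (hev : ev ≤ ε * X)
    (hew : ew * Sx ≤ Φ * X ^ 5 / (2 * (σ * X ^ 2)) + σ * X ^ 2 / 2 * (ε * X) + Γ * X ^ 2 + C₃ * Sx)
    (hε : ε ≤ c' * J / 8) (hσ1 : Φ / (2 * σ * c') ≤ c' * J / 8) (hσ2 : σ * ε / (2 * c') ≤ c' * J / 8)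
    (hT : 8 * (Γ / c' + C₃) / (c' * J) ≤ X) :
    c' / 2 * J * X ≤ G := by
  have hSx : 0 < Sx := lt_of_lt_of_le (by positivity) hS
  have h1 : J * (c' * X) ≤ J * (Sx / X) := by
    refine mul_le_mul_of_nonneg_left ?_ hJ.le
    rw [le_div_iff₀ hX]
    nlinarith [hS]
  have hev' : ev ≤ c' * J / 8 * X := hev.trans (mul_le_mul_of_nonneg_right hε hX.le)
  have h2 : ew ≤ c' * J / 8 * X + c' * J / 8 * X + Γ / c' + C₃ := by
    have ha : Φ / (2 * σ) ≤ c' * J / 8 * c' := by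
      rw [div_le_iff₀ (by positivity)] at hσ1 ⊢
      nlinarith
    have hb : σ * ε / 2 ≤ c' * J / 8 * c' := by
      rw [div_le_iff₀ (by positivity)] at hσ2 ⊢
      nlinarith
    have hX3 : (0 : ℝ) ≤ X ^ 3 := by positivity
    have hM : ew * Sx ≤ (c' * J / 8 * X + c' * J / 8 * X + Γ / c') * (c' * X ^ 2) + C₃ * Sx := by
      have e1 : Φ * X ^ 5 / (2 * (σ * X ^ 2)) + σ * X ^ 2 / 2 * (ε * X) + Γ * X ^ 2 =
          Φ / (2 * σ) * X ^ 3 + σ * ε / 2 * X ^ 3 + Γ * X ^ 2 := by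
        field_simp
      have e2 : (c' * J / 8 * X + c' * J / 8 * X + Γ / c') * (c' * X ^ 2) =
          c' * J / 8 * c' * X ^ 3 + c' * J / 8 * c' * X ^ 3 + Γ * X ^ 2 := by
        field_simp
      rw [e1] at hew
      rw [e2]
      nlinarith [mul_le_mul_of_nonneg_right ha hX3, mul_le_mul_of_nonneg_right hb hX3]
    have hBc : 0 ≤ c' * J / 8 * X + c' * J / 8 * X + Γ / c' := by positivity
    have h3 : (ew - C₃) * Sx ≤ (c' * J / 8 * X + c' * J / 8 * X + Γ / c') * Sx := by
      nlinarith [mul_le_mul_of_nonneg_left hS hBc]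
    have h4 := le_of_mul_le_mul_right h3 hSx
    linarith
  have h3 : Γ / c' + C₃ ≤ c' * J / 8 * X := by
    rw [div_le_iff₀ (by positivity)] at hT
    linarith
  linarith

end Abstract

section Torus

/-- `A`-energy versus `H`-energy on an `N`-particle vector: `Re⟨z, (H - μN̂)z⟩ = Re⟨z, Hz⟩ - μN‖z‖²`.
Tasaki (2020) §2.2. [folklore] -/
theorem re_rayleigh_hubbardTorusWith (L : ℕ) [NeZero L] (U μ : ℝ) {Nn : ℕ}
    {z : Fock (Orb (FermionTorus 2 L))} (hz : IsNParticle Nn z) :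
    (star z ⬝ᵥ hubbardTorusWith 2 L 1 U μ *ᵥ z).re =
      (star z ⬝ᵥ hubbardTorus 2 L 1 U *ᵥ z).re - μ * Nn * (star z ⬝ᵥ z).re := by
  rw [hubbardTorusWith_eq, sub_mulVec, smul_mulVec, totalNumber_mulVec_of_isNParticle hz,
    smul_smul, dotProduct_sub, dotProduct_smul, Complex.sub_re, smul_eq_mul,
    ← Complex.ofReal_natCast, ← Complex.ofReal_mul, Complex.re_ofReal_mul]

end Torus

end Summit.HubbardSuperconductivity.HubbardSuperconductivity.Theorems.JosephsonMirror
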